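import Mathlib
import Summits.ValiantsHypothesis.ValiantsHypothesis.Theorems.RigidityForcesSymmetryRankRigidMinimalReprLaplaceFiveSeparatedCaptureLinesNonparallel
import Summits.ValiantsHypothesis.ValiantsHypothesis.Theorems.RigidityForcesSymmetryRankRigidMinimalReprLaplaceFiveSeparatedCaptureTwoK2Hub

/-!
# ValiantsHypothesis / RigidityForcesSymmetry — crux `LaplaceOptimalFive` (stmt-ValiantsHypothesis-24813), symmetric capture:
# **DISTINCT LINES, PARALLEL BRANCH — `finrank W ≤ 2`** (the last piece of the profile `(1,1,1)` of `CaptureIneqSym`)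

Memo `pub/val-lit/lmr/NOTE-p4g17-24813-K32-symmetric-capture.md` §11–§12 (val-lit-p4 g17), the successor step after
✓ `finrank_le_three_of_equalLines` (equal lines) and ✓ `lines_nonparallel_vanish` (a non-parallel pair of placement vectors kills the
obligation).  Triangle spans are LINES `ℂu₁, ℂu₂, ℂu₃` (`u_i` symmetric); a captured obligation reads
`T(p,q,r) = u₁(p,q)a_r + u₂(p,r)b_q + u₃(q,r)c_p`.

* `lines_nonparallel_vanish_ac`, `lines_nonparallel_vanish_bc` — the relabelled forms of ✓ `lines_nonparallel_vanish` (minors of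
  `(a,c)`, `(b,c)`), read off the slot symmetries of `T`.
* `lines_vanish_of_a_zero` — a non-zero obligation has `a ≠ 0` (with `a = 0` the symmetries force `u₂ ∝ b bᵀ`, `u₃ ∝ c cᵀ`, `b ∥ c`
  and then the repeated-letter vanishing kills `T`).
* ★ `lines_parallel_structure` — PER-OBLIGATION STRUCTURE: a non-zero obligation has `b = β·a`, `c = γ·a`, `u₁ − β·u₂ = κ·a aᵀ`
  (✓ `rankOne_of_tensor_symm`) and `T = P(u₁ ⊗ a) − λ·a⊗a⊗a`, `P(u ⊗ a)(p,q,r) = u(p,q)a_r + u(p,r)a_q + u(q,r)a_p`.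
* ★★ `finrank_le_two_of_lines` — if `u₁ ∉ ℂ·u₂` then `finrank W ≤ 2`: two non-zero obligations with NON-PARALLEL vectors `a, a′`
  would put `u₁, u₂` into `span(a aᵀ, a′ a′ᵀ)`, hence every obligation would be annihilated in its first slot by `⟨a, a′⟩^⊥` and vanish
  (✓ `LaplaceFiveStar.sqfree_symm3_eq_zero`); so all vectors lie on one line `ℂa₀` and every obligation lies in
  `span{P(u₁ ⊗ a₀), a₀⊗a₀⊗a₀}`.  (With ✓ `finrank_le_three_of_equalLines` this completes the profile `(1,1,1)`; the assembly in
  `CaptureIneqSym`'s currency is the sibling file `…SeparatedCaptureLines`.)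

Honest framing.  A SUB-CASE (profile `(1,1,1)`) of the OPEN inequality `CaptureIneqSym`; K1 on `K₃ ⊔ K₂` in general, S2′,
`LaplaceOptimalFive` (OPEN · CONTESTED 72/120), `RankRigidMinimalRepr`, `VP ≠ VNP` are NOT proved.  No definitions, no `sorry`.
-/

set_option linter.dupNamespace false
set_option autoImplicit false

namespace Summit.ValiantsHypothesis.ValiantsHypothesis.Theorems.RigidityForcesSymmetryRankRigidMinimalRepr

namespace LaplaceFiveSeparatedCapture

open Finset LaplaceFiveSectorSplit

section obligation

variable (u₁ u₂ u₃ : Fin 5 → Fin 5 → ℂ)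
  (hu₁ : ∀ p q, u₁ p q = u₁ q p) (hu₂ : ∀ p q, u₂ p q = u₂ q p) (hu₃ : ∀ p q, u₃ p q = u₃ q p)
  (T : Fin 5 → Fin 5 → Fin 5 → ℂ) (a b c : Fin 5 → ℂ)
  (hT : ∀ p q r, T p q r = u₁ p q * a r + u₂ p r * b q + u₃ q r * c p)
  (h12 : ∀ p q r, T p q r = T q p r) (h23 : ∀ p q r, T p q r = T p r q) (hrep : ∀ p r, T p p r = 0)
include hu₁ hu₂ hu₃ hT h12 h23 hrep

/-- Relabelled ✓ `lines_nonparallel_vanish`: a non-zero `2 × 2` minor of `(a, c)` kills the obligation. [folklore] -/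
theorem lines_nonparallel_vanish_ac (r₁ r₂ : Fin 5) (hmin : a r₁ * c r₂ - a r₂ * c r₁ ≠ 0) (p q r : Fin 5) :
    T p q r = 0 := by
  -- `T(q,p,r)` has the same shape with `(u₂,b) ↔ (u₃,c)`
  have hT' : ∀ p q r, (fun p q r => T q p r) p q r = u₁ p q * a r + u₃ p r * c q + u₂ q r * b p := by
    intro p q r; show T q p r = _; rw [hT q p r, hu₁ q p]; ring
  have h := lines_nonparallel_vanish u₁ u₃ u₂ hu₁ hu₃ hu₂ (fun p q r => T q p r) a c b hT'
    (fun p q r => h12 q p r) (fun p q r => by show T q p r = T r p q; rw [← h12 p q r, h23 p q r, h12 p r q])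
    (fun p r => hrep p r) r₁ r₂ hmin q p r
  exact h

/-- Relabelled ✓ `lines_nonparallel_vanish`: a non-zero `2 × 2` minor of `(c, b)` kills the obligation. [folklore] -/
theorem lines_nonparallel_vanish_bc (r₁ r₂ : Fin 5) (hmin : c r₁ * b r₂ - c r₂ * b r₁ ≠ 0) (p q r : Fin 5) :
    T p q r = 0 := by
  -- `T(r,q,p)` has the same shape with `(u₁,a) ↔ (u₃,c)`
  have h13 : ∀ p q r, T p q r = T r q p := fun p q r => by rw [h12, h23, h12]
  have hT' : ∀ p q r, (fun p q r => T r q p) p q r = u₃ p q * c r + u₂ p r * b q + u₁ q r * a p := by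
    intro p q r; show T r q p = _; rw [hT r q p, hu₃ q p, hu₂ r p, hu₁ r q]; ring
  have h := lines_nonparallel_vanish u₃ u₂ u₁ hu₃ hu₂ hu₁ (fun p q r => T r q p) c b a hT'
    (fun p q r => h23 r q p) (fun p q r => h12 r q p)
    (fun p r => by show T r p p = 0; rw [← h13 p p r]; exact hrep p r) r₁ r₂ hmin r q p
  exact h

/-- A non-trivial obligation on three lines has `a ≠ 0`: with `a = 0` the slot symmetries make `u₂ ⊗ b` symmetric and tie
`γ·u₃` to `−κ·b bᵀ`, and the repeated-letter vanishing kills `T`. [folklore] -/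
theorem lines_vanish_of_a_zero (ha : ∀ r, a r = 0) (p q r : Fin 5) : T p q r = 0 := by
  -- if some minor of (c,b) is non-zero we are done
  by_cases hmin : ∃ r₁ r₂, c r₁ * b r₂ - c r₂ * b r₁ ≠ 0
  · obtain ⟨r₁, r₂, h⟩ := hmin
    exact lines_nonparallel_vanish_bc u₁ u₂ u₃ hu₁ hu₂ hu₃ T a b c hT h12 h23 hrep r₁ r₂ h p q r
  push Not at hmin
  have hmin' : ∀ r₁ r₂, b r₁ * c r₂ = b r₂ * c r₁ := fun r₁ r₂ => by linear_combination (sub_eq_zero.mp (hmin r₂ r₁))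
  have hT0 : ∀ p q r, T p q r = u₂ p r * b q + u₃ q r * c p := fun p q r => by rw [hT, ha]; ring
  have h13 : ∀ p q r, T p q r = T r q p := fun p q r => by rw [h12, h23, h12]
  by_cases hb : ∀ r, b r = 0
  · -- `T = u₃ ⊗ c` placed on `(1,2 | 0)`
    have hT1 : ∀ p q r, T p q r = u₃ q r * c p := fun p q r => by rw [hT0, hb]; ring
    by_cases hcp : c p = 0
    · rw [hT1, hcp, mul_zero]
    · have h1 : u₃ q p * c p = 0 := by rw [← hT1 p q p, ← h23 p p q]; exact hrep p q
      have h2 : u₃ q p = 0 := by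
        rcases mul_eq_zero.mp h1 with h | h
        · exact h
        · exact absurd h hcp
      rw [h13, hT1, h2, zero_mul]
  · push Not at hb
    obtain ⟨r₀, hr₀⟩ := hb
    have hcb : c = (c r₀ / b r₀) • b := twoTerm_parallel b c hmin' r₀ hr₀
    set γ := c r₀ / b r₀ with hγ
    have hc : ∀ r, c r = γ * b r := fun r => by rw [hcb]; rfl
    -- `h23` makes `u₂ ⊗ b` symmetric ⇒ `u₂ = κ b bᵀ`
    have hsym2 : ∀ p' q' r', u₂ p' q' * b r' = u₂ p' r' * b q' := by
      intro p' q' r'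
      have h := h23 p' r' q'
      rw [hT0, hT0, hu₃ r' q'] at h
      linear_combination h
    have hu2 := rankOne_of_tensor_symm u₂ b hu₂ hsym2 r₀ hr₀
    set κ := u₂ r₀ r₀ / b r₀ ^ 2 with hκ
    have hT2 : ∀ p q r, T p q r = κ * b p * b r * b q + γ * u₃ q r * b p := by
      intro p q r; rw [hT0, hu2, hc]; ring
    -- the key identity `γ·u₃(p,r) = −κ·b_p b_r`
    have hE3 : ∀ r, γ * u₃ r₀ r = -κ * b r₀ * b r := by
      intro r
      have h := hrep r₀ r
      rw [hT2] at h
      have h' : b r₀ * (κ * b r₀ * b r + γ * u₃ r₀ r) = 0 := by linear_combination h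
      rcases mul_eq_zero.mp h' with h1 | h1
      · exact absurd h1 hr₀
      · linear_combination h1
    have hK : ∀ p r, γ * u₃ p r = -κ * b p * b r := by
      intro p r
      have h := h12 p r₀ r
      rw [hT2, hT2] at h
      have h' : (γ * u₃ p r) * b r₀ = (γ * u₃ r₀ r) * b p := by linear_combination -h
      rw [hE3 r] at h'
      have h'' : b r₀ * (γ * u₃ p r + κ * b p * b r) = 0 := by linear_combination h'
      rcases mul_eq_zero.mp h'' with h1 | h1
      · exact absurd h1 hr₀
      · linear_combination h1
    rw [hT2]
    have := hK q r
    linear_combination b p * this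

/-- ★ PER-OBLIGATION STRUCTURE on three lines (parallel branch): a non-zero obligation has `a ≠ 0`, `b = β·a`,
`u₁ − β·u₂ = κ·a aᵀ`, and `T = P(u₁ ⊗ a) − λ·a⊗a⊗a`. [folklore] -/
theorem lines_parallel_structure (hne : ∃ p q r, T p q r ≠ 0) :
    ∃ r₀ : Fin 5, a r₀ ≠ 0 ∧ ∃ β κ lam : ℂ, (∀ r, b r = β * a r) ∧
      (∀ p q, u₁ p q - β * u₂ p q = κ * (a p * a q)) ∧
      (∀ p q r, T p q r = u₁ p q * a r + u₁ p r * a q + u₁ q r * a p - lam * (a p * a q * a r)) := by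
  obtain ⟨p₀, q₀, s₀, hne⟩ := hne
  -- `a ≠ 0`
  have ha : ∃ r₀, a r₀ ≠ 0 := by
    by_contra h
    push Not at h
    exact hne (lines_vanish_of_a_zero u₁ u₂ u₃ hu₁ hu₂ hu₃ T a b c hT h12 h23 hrep h p₀ q₀ s₀)
  obtain ⟨r₀, hr₀⟩ := ha
  -- all minors of `(a,b)` and `(a,c)` vanish
  have hab : ∀ r₁ r₂, a r₁ * b r₂ = a r₂ * b r₁ := by
    intro r₁ r₂
    by_contra h
    exact hne (lines_nonparallel_vanish u₁ u₂ u₃ hu₁ hu₂ hu₃ T a b c hT h12 h23 hrep r₁ r₂ (sub_ne_zero.mpr h) p₀ q₀ s₀)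
  have hac : ∀ r₁ r₂, a r₁ * c r₂ = a r₂ * c r₁ := by
    intro r₁ r₂
    by_contra h
    exact hne (lines_nonparallel_vanish_ac u₁ u₂ u₃ hu₁ hu₂ hu₃ T a b c hT h12 h23 hrep r₁ r₂ (sub_ne_zero.mpr h) p₀ q₀ s₀)
  have hb' := twoTerm_parallel a b hab r₀ hr₀
  have hc' := twoTerm_parallel a c hac r₀ hr₀
  set β := b r₀ / a r₀ with hβ
  set γ := c r₀ / a r₀ with hγ
  have hb : ∀ r, b r = β * a r := fun r => by rw [hb']; rfl
  have hc : ∀ r, c r = γ * a r := fun r => by rw [hc']; rfl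
  -- `h23` ⇒ `(u₁ − β u₂) ⊗ a` symmetric ⇒ rank one
  have hM : ∀ p q r, (u₁ p q - β * u₂ p q) * a r = (u₁ p r - β * u₂ p r) * a q := by
    intro p q r
    have h := h23 p q r
    rw [hT, hT] at h
    simp only [hb, hc] at h
    rw [hu₃ r q] at h
    linear_combination h
  have hMsym : ∀ p q, u₁ p q - β * u₂ p q = u₁ q p - β * u₂ q p := fun p q => by rw [hu₁ p q, hu₂ p q]
  have hM1 := rankOne_of_tensor_symm (fun p q => u₁ p q - β * u₂ p q) a hMsym hM r₀ hr₀
  set κ := (u₁ r₀ r₀ - β * u₂ r₀ r₀) / a r₀ ^ 2 with hκ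
  -- `h12` ⇒ `(β u₂ − γ u₃) ⊗ a` symmetric ⇒ rank one
  have hN : ∀ p q r, (β * u₂ p q - γ * u₃ p q) * a r = (β * u₂ p r - γ * u₃ p r) * a q := by
    intro p q r
    have h := h12 q r p
    rw [hT, hT] at h
    simp only [hb, hc] at h
    rw [hu₁ q r, hu₂ q p, hu₃ r p, hu₂ r p, hu₃ q p] at h
    linear_combination h
  have hNsym : ∀ p q, β * u₂ p q - γ * u₃ p q = β * u₂ q p - γ * u₃ q p := fun p q => by rw [hu₂ p q, hu₃ p q]
  have hN1 := rankOne_of_tensor_symm (fun p q => β * u₂ p q - γ * u₃ p q) a hNsym hN r₀ hr₀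
  set κ' := (β * u₂ r₀ r₀ - γ * u₃ r₀ r₀) / a r₀ ^ 2 with hκ'
  refine ⟨r₀, hr₀, β, κ, 2 * κ + κ', hb, fun p q => ?_, fun p q r => ?_⟩
  · have := hM1 p q; linear_combination this
  · have e1 : β * u₂ p r = u₁ p r - κ * (a p * a r) := by
      have := hM1 p r; linear_combination -this
    have e2 : γ * u₃ q r = β * u₂ q r - κ' * (a q * a r) := by
      have := hN1 q r; linear_combination -this
    have e3 : β * u₂ q r = u₁ q r - κ * (a q * a r) := by
      have := hM1 q r; linear_combination -this
    rw [hT, hb, hc]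
    linear_combination a q * e1 + a p * e2 + a p * e3

end obligation

/-! ### Two linear-algebra bricks for the count -/

/-- If `κ·a aᵀ = κ₀·a₀ a₀ᵀ` with `κ ≠ 0` and `a ≠ 0`, then `a₀ ∥ a` (all `2 × 2` minors vanish). [folklore] -/
theorem minors_of_rankOne_eq (κ κ₀ : ℂ) (a a₀ : Fin 5 → ℂ) (hκ : κ ≠ 0) (r₁ : Fin 5) (hr₁ : a r₁ ≠ 0)
    (h : ∀ p q, κ * (a p * a q) = κ₀ * (a₀ p * a₀ q)) (i j : Fin 5) : a₀ i * a j = a₀ j * a i := by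
  by_cases h0 : a₀ i = 0
  · have h1 := h i r₁
    rw [h0, zero_mul, mul_zero] at h1
    have hai : a i = 0 := by
      rcases mul_eq_zero.mp h1 with h2 | h2
      · exact absurd h2 hκ
      · rcases mul_eq_zero.mp h2 with h3 | h3
        · exact h3
        · exact absurd h3 hr₁
    rw [h0, hai, zero_mul, mul_zero]
  · have h1 := h i i
    have h2 := h i j
    have h3 : κ * (a i * a j) * (κ₀ * (a₀ i * a₀ i)) = κ * (a i * a i) * (κ₀ * (a₀ i * a₀ j)) := by
      rw [← h1, ← h2]; ring
    have hκ₀ : κ₀ ≠ 0 := by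
      intro hz; rw [hz, zero_mul] at h1
      rcases mul_eq_zero.mp h1 with h4 | h4
      · exact hκ h4
      · have : a i = 0 := by simpa using mul_self_eq_zero.mp h4
        have h5 := h r₁ r₁
        rw [hz, zero_mul] at h5
        rcases mul_eq_zero.mp h5 with h6 | h6
        · exact hκ h6
        · exact hr₁ (by simpa using mul_self_eq_zero.mp h6)
    have h4 : κ * κ₀ * a₀ i * a i * (a₀ i * a j - a₀ j * a i) = 0 := by linear_combination h3
    rcases mul_eq_zero.mp h4 with h5 | h5
    · rcases mul_eq_zero.mp h5 with h6 | h6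
      · rcases mul_eq_zero.mp h6 with h7 | h7
        · rcases mul_eq_zero.mp h7 with h8 | h8
          · exact absurd h8 hκ
          · exact absurd h8 hκ₀
        · exact absurd h7 h0
      · have h7 := h i r₁
        rw [h6, zero_mul, mul_zero] at h7
        have h8 : a₀ r₁ = 0 := by
          rcases mul_eq_zero.mp h7.symm with h9 | h9
          · exact absurd h9 hκ₀
          · rcases mul_eq_zero.mp h9 with h10 | h10
            · exact absurd h10 h0
            · exact h10
        have h9 := h r₁ r₁
        rw [h8, mul_zero, mul_zero] at h9
        rcases mul_eq_zero.mp h9 with h10 | h10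
        · exact absurd h10 hκ
        · exact absurd (by simpa using mul_self_eq_zero.mp h10) hr₁
    · exact sub_eq_zero.mp h5

/-- Two rank-one relations in the pencil with DIFFERENT `β`: `u₁ − β u₂ = κ·a aᵀ`, `u₁ − β₀ u₂ = κ₀·a₀ a₀ᵀ`, `β ≠ β₀` — then
`u₁` and `u₂` are annihilated by every `y ⊥ a, a₀`. [folklore] -/
theorem annihilate_of_two_relations (u₁ u₂ : Fin 5 → Fin 5 → ℂ) (β β₀ κ κ₀ : ℂ) (a a₀ : Fin 5 → ℂ) (hβ : β ≠ β₀)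
    (hM : ∀ p q, u₁ p q - β * u₂ p q = κ * (a p * a q)) (hM₀ : ∀ p q, u₁ p q - β₀ * u₂ p q = κ₀ * (a₀ p * a₀ q))
    (y : Fin 5 → ℂ) (hya : ∑ p, y p * a p = 0) (hya₀ : ∑ p, y p * a₀ p = 0) (q : Fin 5) :
    (∑ p, y p * u₁ p q) = 0 ∧ (∑ p, y p * u₂ p q) = 0 := by
  have hu₂ : ∀ p, (β₀ - β) * u₂ p q = κ * (a p * a q) - κ₀ * (a₀ p * a₀ q) := by
    intro p; linear_combination hM p q - hM₀ p q
  have h2 : (β₀ - β) * ∑ p, y p * u₂ p q = 0 := by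
    rw [Finset.mul_sum]
    have : ∀ p, (β₀ - β) * (y p * u₂ p q) = κ * a q * (y p * a p) - κ₀ * a₀ q * (y p * a₀ p) := by
      intro p; linear_combination y p * hu₂ p
    rw [Finset.sum_congr rfl fun p _ => this p, Finset.sum_sub_distrib, ← Finset.mul_sum, ← Finset.mul_sum, hya, hya₀]
    ring
  have hβ' : β₀ - β ≠ 0 := sub_ne_zero.mpr (Ne.symm hβ)
  have hU2 : ∑ p, y p * u₂ p q = 0 := (mul_eq_zero.mp h2).resolve_left hβ'
  refine ⟨?_, hU2⟩
  have : ∀ p, y p * u₁ p q = β * (y p * u₂ p q) + κ * a q * (y p * a p) := by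
    intro p; linear_combination y p * hM p q
  rw [Finset.sum_congr rfl fun p _ => this p, Finset.sum_add_distrib, ← Finset.mul_sum, ← Finset.mul_sum, hU2, hya]
  ring

/-! ### ★★ The count on distinct lines -/

/-- ★★ **DISTINCT LINES, PARALLEL BRANCH: `finrank W ≤ 2`.**  Let the three triangle spans be the lines through symmetric
`u₁, u₂, u₃` with `u₁ ∉ ℂ·u₂`, and let every obligation of `W` (symmetric zero-diagonal leaf matrices) read
`u₁(p,q)a_r + u₂(p,r)b_q + u₃(q,r)c_p`.  Then `finrank W ≤ 2`: all non-zero obligations share ONE placement line `ℂa₀` (two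
non-parallel ones would put `u₁, u₂` into `span(a aᵀ, a′a′ᵀ)` and ✓ `sqfree_symm3_eq_zero` would kill every obligation), so every
obligation lies in `span{P(u₁ ⊗ a₀), a₀⊗a₀⊗a₀}`. [folklore] -/
theorem finrank_le_two_of_lines (u₁ u₂ u₃ : Fin 5 → Fin 5 → ℂ)
    (hu₁ : ∀ p q, u₁ p q = u₁ q p) (hu₂ : ∀ p q, u₂ p q = u₂ q p) (hu₃ : ∀ p q, u₃ p q = u₃ q p)
    (h12np : ¬ ∃ κ : ℂ, u₁ = κ • u₂)
    (W : Submodule ℂ (Fin 5 → Fin 5 → ℂ))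
    (hWs : ∀ μ ∈ W, ∀ s t : Fin 5, μ s t = μ t s) (hWd : ∀ μ ∈ W, ∀ s : Fin 5, μ s s = 0)
    (hWc : ∀ μ ∈ W, ∃ a b c : Fin 5 → ℂ, ∀ p q r, contractZ μ p q r = u₁ p q * a r + u₂ p r * b q + u₃ q r * c p) :
    Module.finrank ℂ W ≤ 2 := by
  classical
  have hS12 : ∀ μ (p q r : Fin 5), contractZ μ p q r = contractZ μ q p r := fun μ p q r => (contractZ_swap12 μ p q r).symm
  have hS23 : ∀ μ (p q r : Fin 5), contractZ μ p q r = contractZ μ p r q := fun μ p q r => (contractZ_swap23 μ p q r).symm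
  -- structure of a non-zero obligation
  have hstruct : ∀ μ ∈ W, (∃ p q r, contractZ μ p q r ≠ 0) →
      ∃ a : Fin 5 → ℂ, (∃ r₀, a r₀ ≠ 0) ∧ ∃ β κ lam : ℂ,
        (∀ p q, u₁ p q - β * u₂ p q = κ * (a p * a q)) ∧ κ ≠ 0 ∧
        (∀ p q r, contractZ μ p q r = u₁ p q * a r + u₁ p r * a q + u₁ q r * a p - lam * (a p * a q * a r)) ∧
        (∀ y : Fin 5 → ℂ, (∑ p, y p * a p) = 0 → (∀ q, ∑ p, y p * u₁ p q = 0) → (∀ q, ∑ p, y p * u₂ p q = 0) →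
          ∀ q r, ∑ p, y p * contractZ μ p q r = 0) := by
    intro μ hμ hne
    obtain ⟨a, b, c, hT⟩ := hWc μ hμ
    obtain ⟨r₀, hr₀, β, κ, lam, hb, hM, hP⟩ := lines_parallel_structure u₁ u₂ u₃ hu₁ hu₂ hu₃ (contractZ μ) a b c hT
      (hS12 μ) (hS23 μ) (fun p r => contractZ_rep12 μ p r) hne
    have hκ : κ ≠ 0 := by
      intro h0
      apply h12np
      refine ⟨β, funext fun p => funext fun q => ?_⟩
      have := hM p q; rw [h0, zero_mul, sub_eq_zero] at this
      simpa [Pi.smul_apply, smul_eq_mul] using this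
    -- `c ∥ a`
    have hac : ∀ r₁ r₂, a r₁ * c r₂ = a r₂ * c r₁ := by
      intro r₁ r₂
      by_contra h
      obtain ⟨p₀, q₀, s₀, hne⟩ := hne
      exact hne (lines_nonparallel_vanish_ac u₁ u₂ u₃ hu₁ hu₂ hu₃ (contractZ μ) a b c hT (hS12 μ) (hS23 μ)
        (fun p r => contractZ_rep12 μ p r) r₁ r₂ (sub_ne_zero.mpr h) p₀ q₀ s₀)
    have hc' := twoTerm_parallel a c hac r₀ hr₀
    have hc : ∀ r, c r = c r₀ / a r₀ * a r := fun r => by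
      have := congrFun hc' r; simpa [Pi.smul_apply, smul_eq_mul] using this
    refine ⟨a, ⟨r₀, hr₀⟩, β, κ, lam, hM, hκ, hP, fun y hya hy1 hy2 q r => ?_⟩
    have hyc : ∑ i, c i * y i = 0 := by
      have : ∀ i, c i * y i = c r₀ / a r₀ * (y i * a i) := fun i => by rw [hc]; ring
      rw [Finset.sum_congr rfl fun i _ => this i, ← Finset.mul_sum, hya, mul_zero]
    rw [lines_slot1 u₁ u₂ u₃ hu₁ hu₂ (contractZ μ) a b c hT y q r, hyc]
    have e1 : ∑ p, u₁ q p * y p = 0 := by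
      rw [← hy1 q]; exact Finset.sum_congr rfl fun p _ => by rw [hu₁ q p]; ring
    have e2 : ∑ p, u₂ r p * y p = 0 := by
      rw [← hy2 r]; exact Finset.sum_congr rfl fun p _ => by rw [hu₂ r p]; ring
    rw [e1, e2]; ring
  -- Case 1: every obligation vanishes ⇒ `W = ⊥`
  by_cases hall : ∀ μ ∈ W, ∀ p q r, contractZ μ p q r = 0
  · have hbot : W = ⊥ := by
      rw [Submodule.eq_bot_iff]
      intro μ hμ
      refine hub_injective μ (hWs μ hμ) (hWd μ hμ) fun p q => ?_
      simp [hall μ hμ]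
    rw [hbot, finrank_bot]; exact Nat.zero_le _
  push Not at hall
  obtain ⟨μ₀, hμ₀, p₀, q₀, s₀, hne₀⟩ := hall
  obtain ⟨a₀, ⟨r₀, hr₀⟩, β₀, κ₀, lam₀, hM₀, hκ₀, hP₀, hann₀⟩ := hstruct μ₀ hμ₀ ⟨p₀, q₀, s₀, hne₀⟩
  -- the two spanning tensors
  let P₀ : Fin 5 → Fin 5 → Fin 5 → ℂ := fun p q r => u₁ p q * a₀ r + u₁ p r * a₀ q + u₁ q r * a₀ p
  let C₀ : Fin 5 → Fin 5 → Fin 5 → ℂ := fun p q r => a₀ p * a₀ q * a₀ r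
  let Sg : Submodule ℂ (Fin 5 → Fin 5 → Fin 5 → ℂ) := Submodule.span ℂ {P₀, C₀}
  -- every obligation has its placement vector on the line `ℂ a₀`
  have hpar : ∀ μ ∈ W, ∀ (a : Fin 5 → ℂ) (β κ : ℂ), κ ≠ 0 →
      (∀ p q, u₁ p q - β * u₂ p q = κ * (a p * a q)) → (∃ r₁, a r₁ ≠ 0) →
      ∀ i j, a₀ i * a j = a₀ j * a i := by
    intro μ hμ a β κ hκ hM ⟨r₁, hr₁⟩ i j
    by_contra hmin
    -- Case β = β₀: the two rank-one matrices coincide up to scalars ⇒ parallel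
    by_cases hβ : β = β₀
    · apply hmin
      refine minors_of_rankOne_eq κ κ₀ a a₀ hκ r₁ hr₁ (fun p q => ?_) i j
      rw [← hM p q, ← hM₀ p q, hβ]
    -- Case β ≠ β₀: `u₁, u₂` annihilated by `⟨a, a₀⟩^⊥` ⇒ every obligation of `W` vanishes ⇒ contradiction with `μ₀`
    have hann : ∀ v : Fin 5 → ℂ, (∑ x, v x * a x) = 0 → (∑ x, v x * a₀ x) = 0 →
        ∀ q r, ∑ p, v p * contractZ μ₀ p q r = 0 := by
      intro v hva hva₀ q r
      have h12' := annihilate_of_two_relations u₁ u₂ β β₀ κ κ₀ a a₀ hβ hM hM₀ v hva hva₀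
      exact hann₀ v hva₀ (fun q => (h12' q).1) (fun q => (h12' q).2) q r
    exact hne₀ (LaplaceFiveStar.sqfree_symm3_eq_zero (contractZ μ₀) (fun x y z => hS12 μ₀ x y z)
      (fun x y z => hS23 μ₀ x y z) (fun x z => contractZ_rep12 μ₀ x z) a a₀ hann p₀ q₀ s₀)
  -- hence every obligation lies in `Sg`
  have hmem : ∀ μ ∈ W, contractZ μ ∈ Sg := by
    intro μ hμ
    by_cases hz : ∀ p q r, contractZ μ p q r = 0
    · have : contractZ μ = 0 := funext fun p => funext fun q => funext fun r => hz p q r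
      rw [this]; exact Sg.zero_mem
    push Not at hz
    obtain ⟨a, ⟨r₁, hr₁⟩, β, κ, lam, hM, hκ, hP, -⟩ := hstruct μ hμ hz
    have hmin := hpar μ hμ a β κ hκ hM ⟨r₁, hr₁⟩
    have ha' := twoTerm_parallel a₀ a hmin r₀ hr₀
    set t := a r₀ / a₀ r₀ with ht
    have ha : ∀ r, a r = t * a₀ r := fun r => by
      have := congrFun ha' r; simpa [Pi.smul_apply, smul_eq_mul] using this
    have hP₀mem : P₀ ∈ Sg := Submodule.subset_span (Set.mem_insert _ _)
    have hC₀mem : C₀ ∈ Sg := Submodule.subset_span (Set.mem_insert_of_mem _ (Set.mem_singleton _))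
    have : contractZ μ = t • P₀ - (lam * t ^ 3) • C₀ := by
      funext p q r
      simp only [Pi.sub_apply, Pi.smul_apply, smul_eq_mul, P₀, C₀]
      rw [hP, ha, ha, ha]; ring
    rw [this]
    exact Sg.sub_mem (Sg.smul_mem t hP₀mem) (Sg.smul_mem _ hC₀mem)
  -- the count
  let f : W →ₗ[ℂ] Sg := LinearMap.codRestrict Sg (cZ.domRestrict W) (fun μ => by
    simpa [cZ_apply] using hmem μ.1 μ.2)
  have hf : Function.Injective f := by
    rw [injective_iff_map_eq_zero]
    intro μ hμ
    have hT : contractZ μ.1 = 0 := by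
      have := congrArg Subtype.val hμ
      simpa [f, cZ_apply] using this
    apply Subtype.ext
    refine hub_injective μ.1 (hWs μ.1 μ.2) (hWd μ.1 μ.2) fun p q => ?_
    simp [hT]
  have h1 := LinearMap.finrank_le_finrank_of_injective hf
  have h2 : Module.finrank ℂ Sg ≤ 2 := by
    have := finrank_span_le_card (R := ℂ) ({P₀, C₀} : Set (Fin 5 → Fin 5 → Fin 5 → ℂ))
    refine this.trans ?_
    simp only [Set.toFinset_insert, Set.toFinset_singleton]
    exact Finset.card_insert_le _ _
  omega

end LaplaceFiveSeparatedCapture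

end Summit.ValiantsHypothesis.ValiantsHypothesis.Theorems.RigidityForcesSymmetryRankRigidMinimalRepr
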